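import Mathlib
import Summits.ValiantsHypothesis.ValiantsHypothesis.Theorems.LacunarySymmetroidMatrixDescartesTieLawRotation
import Summits.ValiantsHypothesis.ValiantsHypothesis.Theorems.LacunarySymmetroidMatrixDescartesTieLawRootExit
import HarnessLib

/-!
# ValiantsHypothesis / LacunarySymmetroid — crux `MatrixDescartes` (stmt-ValiantsHypothesis-18050, V1), LINE (A) «product_plus_one»:
# the TIE LAW, kernel path Stage 2, part 3b — the trinomial root count (I5)

`card_roots_gPoly_trinSector`: for `0 < a`, `2a < c` and `β, γ > 0` the real trinomial `g = γ X^c + X^a − β` has exactly ONE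
complex root, counted with multiplicity, in the open sector `{0 < arg ζ < 2π/c}` (`trinSector c`).  This is (I5) of the pen's
§45 proof (HOME NOTE §45.1), proved here by deformation instead of asymptotics: along `g_s = γ X^c + s X^a − β`, `s ∈ (0, 1]`,
no root lies on the two boundary rays except the simple positive real root (which stays real, `real_root_persists`), so the
count is constant (`card_roots_filter_eq_of_preconnected'`); at `s = 0⁺` the roots are the explicit `c`-th roots of `β/γ`
(`gFamC_roots_zero`), of which exactly the one on the ray `arg = 2π/c` ENTERS the sector (`exit_lemma`, velocity
`∝ e^{2πia/c}`), the positive real one stays real, and the others are exterior (`card_roots_filter_eventually_eq`).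
HONEST FRAMING: helper lemmas; no stub of LINE (A) is touched; `MatrixDescartes` OPEN; `VP ≠ VNP` is NOT proved.  No definitions,
no named facts.
-/

set_option linter.dupNamespace false

namespace Summit.ValiantsHypothesis.ValiantsHypothesis.Theorems.LacunarySymmetroidMatrixDescartes

namespace TieLaw

open Polynomial Filter Topology

section Trinomial

variable {a c : ℕ} {β γ : ℝ}

/-- The roots of `γ X^c − β` (`β, γ > 0`): the `c` numbers `e^{2πik/c} r`, `r = (β/γ)^{1/c} > 0`. -/
theorem gFamC_roots_zero (a : ℕ) (hc : 0 < c) (hβ : 0 < β) (hγ : 0 < γ) :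
    ∃ r : ℝ, 0 < r ∧ γ * r ^ c = β ∧
      ((C (γ : ℂ) * X ^ c - C (β : ℂ)) + C ((0 : ℝ) : ℂ) * X ^ a).roots =
        (Multiset.range c).map (fun k => rot (2 * Real.pi / c) ^ k * (r : ℂ)) := by
  have hc0 : c ≠ 0 := hc.ne'
  set r := (β / γ) ^ ((c : ℝ)⁻¹) with hr
  have hr0 : 0 < r := Real.rpow_pos_of_pos (div_pos hβ hγ) _
  have hrc : r ^ c = β / γ := by
    rw [hr, ← Real.rpow_natCast, ← Real.rpow_mul (div_pos hβ hγ).le, inv_mul_cancel₀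
      (by exact_mod_cast hc0), Real.rpow_one]
  refine ⟨r, hr0, by rw [hrc]; field_simp, ?_⟩
  have hγ0 : (γ : ℂ) ≠ 0 := by exact_mod_cast hγ.ne'
  have hpoly : (C (γ : ℂ) * X ^ c - C (β : ℂ)) + C ((0 : ℝ) : ℂ) * X ^ a =
      C (γ : ℂ) * (X ^ c - C ((r : ℂ) ^ c)) := by
    have hb : (β : ℂ) = (γ : ℂ) * (r : ℂ) ^ c := by
      rw [← Complex.ofReal_pow, hrc]
      push_cast
      field_simp
    rw [hb, Complex.ofReal_zero, C_0, zero_mul, add_zero, mul_sub, ← C_mul]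
  rw [hpoly, roots_C_mul _ hγ0]
  exact (isPrimitiveRoot_rot c hc0).nthRoots_eq (α := (r : ℂ)) rfl

open Classical in
/-- **(I5) The trinomial root count.**  For `0 < a`, `2a < c`, `β, γ > 0`, the real trinomial `γ X^c + X^a − β` has exactly
one complex root, counted with multiplicity, in the open sector `{0 < arg ζ < 2π/c}`. -/
theorem card_roots_gPoly_trinSector (ha : 0 < a) (h2a : 2 * a < c) (hβ : 0 < β) (hγ : 0 < γ) :
    (((gPoly a c β γ).map (algebraMap ℝ ℂ)).roots.filter (· ∈ trinSector c)).card = 1 := by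
  classical
  have hac : a < c := by omega
  have hc2 : 2 < c := by omega
  have hc : 0 < c := by omega
  have hc0 : c ≠ 0 := by omega
  have h1c : 1 < c := by omega
  set θ := 2 * Real.pi / c with hθ
  set ζ := rot θ with hζdef
  have hζprim : IsPrimitiveRoot ζ c := isPrimitiveRoot_rot c hc0
  have hζc : ζ ^ c = 1 := hζprim.pow_eq_one
  have hsinθ : 0 < Real.sin θ := sin_two_pi_div_pos hc2
  have hζinv : rot (-θ) = ζ⁻¹ := (eq_inv_of_mul_eq_one_right (rot_mul_rot_neg θ)).symm ▸ rfl
  -- the complex family and its data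
  set A : ℂ[X] := C (γ : ℂ) * X ^ c - C (β : ℂ) with hA
  set B : ℂ[X] := X ^ a with hB
  set P : ℝ → ℂ[X] := fun s => A + C (s : ℂ) * B with hP
  have hPdef : ∀ s, P s = (C (γ : ℂ) * X ^ c - C (β : ℂ)) + C (s : ℂ) * X ^ a := fun s => rfl
  have hPmap : ∀ s, (C γ * X ^ c + C s * X ^ a - C β : ℝ[X]).map (algebraMap ℝ ℂ) = P s :=
    fun s => gFam_map s a c β γ
  have hdeg : ∀ s, (P s).natDegree ≤ c := fun s => gFamC_natDegree_le hac s β γ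
  have htop : ∀ s, (P s).coeff c ≠ 0 := fun s => by
    rw [hPdef, gFamC_coeff_top hac]
    exact_mod_cast hγ.ne'
  have hcont : ∀ k, Continuous fun s => (P s).coeff k := fun k => gFamC_coeff_continuous a c β γ k
  have hP0 : ∀ s, P s ≠ 0 := fun s h => htop s (by rw [h, coeff_zero])
  have hg : (gPoly a c β γ).map (algebraMap ℝ ℂ) = P 1 := by
    rw [← hPmap 1, gPoly, C_1, one_mul]
  -- a real simple root `t > 0` of `g_s` keeps the nearby roots real, hence out of the (open upper) sector
  have hreal : ∀ s : ℝ, 0 ≤ s → ∀ t : ℝ, 0 < t → (P s).eval (t : ℂ) = 0 → ∃ ρ : ℝ, 0 < ρ ∧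
      ∀ᶠ s' in 𝓝 s, ∀ w ∈ (P s').roots, ‖w - (t : ℂ)‖ < ρ → w.im = 0 := by
    intro s hs t ht hroot
    have hroot' : (C γ * X ^ c + C s * X ^ a - C β : ℝ[X]).IsRoot t := by
      rw [hPdef, gFamC_eval_ofReal, Complex.ofReal_eq_zero] at hroot
      rw [IsRoot, gFam_eval, hroot]
    have hder : (C γ * X ^ c + C s * X ^ a - C β : ℝ[X]).derivative.eval t ≠ 0 :=
      (gFam_derivative_eval_pos hc hγ hs β ht).ne'
    obtain ⟨ρ, hρ, hev⟩ := real_root_persists (Q := fun s' : ℝ => (C γ * X ^ c + C s' * X ^ a - C β : ℝ[X]))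
      (fun s' => gFam_natDegree_le hac s' β γ) (fun k => (gFam_coeff_continuous a c β γ k).continuousAt)
      hroot' hder
    refine ⟨ρ, hρ, hev.mono fun s' hs' w hw hwρ => hs' w ?_ hwρ⟩
    rwa [hPmap s']
  -- (1) side information at every s > 0
  have hsideU : ∀ s ∈ Set.Ioi (0 : ℝ), ∀ z ∈ (P s).roots, ∃ ρ : ℝ, 0 < ρ ∧
      ∀ᶠ s' in 𝓝 s, ∀ w ∈ (P s').roots, ‖w - z‖ < ρ → (w ∈ trinSector c ↔ z ∈ trinSector c) := by
    intro s hs z hz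
    have hs : 0 < s := hs
    by_cases h1 : z ∈ trinSector c
    · exact side_of_isOpen P (isOpen_trinSector c) h1 fun w hw => by simp [hw, h1]
    by_cases h2 : z ∈ trinExterior c
    · exact side_of_isOpen P (isOpen_trinExterior c) h2 fun w hw => by
        simp [not_mem_trinSector_of_mem_trinExterior hw, h1]
    have hroot : (P s).eval z = 0 := (mem_roots (hP0 s)).1 hz
    rcases boundary_of_not_mem_trin h1 h2 with ⟨hzim, hq⟩ | ⟨hq, hzim⟩
    · -- z real: z = t with t > 0
      have hzre : z = (z.re : ℂ) := Complex.ext (by simp) (by simp [hzim])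
      have hq' : ((z.re : ℂ) * rot (-θ)).im ≤ 0 := by rw [← hzre]; exact hq
      rw [im_ofReal_mul_rot, Real.sin_neg] at hq'
      have hre0 : 0 ≤ z.re := by nlinarith
      rcases hre0.eq_or_lt with h | h
      · exfalso
        rw [hzre, ← h, hPdef, gFamC_eval] at hroot
        simp [hc0, ha.ne', hβ.ne'] at hroot
      · obtain ⟨ρ, hρ, hev⟩ := hreal s hs.le z.re h (by rw [← hzre]; exact hroot)
        refine ⟨ρ, hρ, hev.mono fun s' hs' w hw hwρ => ?_⟩
        have hwim := hs' w hw (by rw [← hzre]; exact hwρ)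
        have hwU : w ∉ trinSector c := fun hU => by
          rw [mem_trinSector] at hU
          linarith [hU.1]
        simp [hwU, h1]
    · -- z on the ray u e^{iθ}: impossible
      exfalso
      have hzu := eq_ofReal_mul_rot_of_im_eq_zero hq
      set u := (z * rot (-θ)).re with hu
      have him : z.im = u * Real.sin θ := by
        rw [hzu, im_ofReal_mul_rot]
      rcases (show 0 ≤ u by nlinarith).eq_or_lt with h | h
      · rw [hzu, ← h, hPdef, gFamC_eval] at hroot
        simp [hc0, ha.ne', hβ.ne'] at hroot
      · exact gFamC_eval_ray_ne_zero ha h2a hs β γ h (by rw [← hzu, ← hPdef]; exact hroot)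
  -- (2) the roots at s = 0 and their side information as s → 0⁺
  obtain ⟨r, hr0, hγr, hroots0⟩ := gFamC_roots_zero (β := β) (γ := γ) a hc hβ hγ
  have hroots0' : (P 0).roots = (Multiset.range c).map (fun k => ζ ^ k * (r : ℂ)) := hroots0
  have hr0' : (r : ℂ) ≠ 0 := by exact_mod_cast hr0.ne'
  have hz1im : 0 < (ζ * (r : ℂ)).im := by
    rw [hζdef, im_rot_mul_ofReal]
    exact mul_pos hsinθ hr0
  have hside0 : ∀ z ∈ (P 0).roots, ∃ ρ : ℝ, 0 < ρ ∧ ∀ᶠ s in 𝓝[>] (0 : ℝ),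
      ∀ w ∈ (P s).roots, ‖w - z‖ < ρ → (w ∈ trinSector c ↔ z = ζ * (r : ℂ)) := by
    intro z hz
    rw [hroots0'] at hz
    obtain ⟨k, hk, rfl⟩ := Multiset.mem_map.1 hz
    rw [Multiset.mem_range] at hk
    rcases Nat.lt_or_ge k 2 with hk2 | hk2
    · interval_cases k
      · -- k = 0: the positive real root r stays real
        have hroot : (P 0).eval (r : ℂ) = 0 := by
          rw [hPdef, gFamC_eval_ofReal, Complex.ofReal_eq_zero, zero_mul, add_zero, hγr, sub_self]
        obtain ⟨ρ, hρ, hev⟩ := hreal 0 le_rfl r hr0 hroot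
        refine ⟨ρ, hρ, (hev.filter_mono nhdsWithin_le_nhds).mono fun s hs' w hw hwρ => ?_⟩
        rw [pow_zero, one_mul] at hwρ ⊢
        have hwim := hs' w hw hwρ
        have hwU : w ∉ trinSector c := fun hU => by
          rw [mem_trinSector] at hU
          linarith [hU.1]
        have hne : (r : ℂ) ≠ ζ * (r : ℂ) := by
          intro h
          have := congrArg Complex.im h
          rw [Complex.ofReal_im] at this
          linarith
        simp [hwU, hne]
      · -- k = 1: the root ζ r enters the sector
        rw [pow_one]
        have hzA : A.IsRoot (ζ * (r : ℂ)) := by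
          rw [IsRoot, hA, eval_sub, eval_mul, eval_C, eval_pow, eval_X, eval_C, mul_pow, hζc, one_mul,
            ← Complex.ofReal_pow, ← Complex.ofReal_mul, hγr, sub_self]
        have hA' : A.derivative.eval (ζ * (r : ℂ)) = (γ : ℂ) * c * (ζ * (r : ℂ)) ^ (c - 1) := by
          have hAd : A.derivative = C ((γ : ℂ) * c) * X ^ (c - 1) := by
            rw [hA, derivative_sub, derivative_C, sub_zero, derivative_C_mul_X_pow]
          rw [hAd, eval_mul, eval_C, eval_pow, eval_X]
        have hζr0 : ζ * (r : ℂ) ≠ 0 := mul_ne_zero (rot_ne_zero θ) hr0'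
        have hane : A.derivative.eval (ζ * (r : ℂ)) ≠ 0 := by
          rw [hA']
          have : (γ : ℂ) ≠ 0 := by exact_mod_cast hγ.ne'
          have : (c : ℂ) ≠ 0 := by exact_mod_cast hc0
          exact mul_ne_zero (mul_ne_zero ‹(γ : ℂ) ≠ 0› ‹(c : ℂ) ≠ 0›) (pow_ne_zero _ hζr0)
        have hd : -ζ ≠ 0 := neg_ne_zero.2 (rot_ne_zero θ)
        -- the velocity quotient
        set K : ℝ := r ^ a / (γ * c * r ^ (c - 1)) with hK
        have hKpos : 0 < K := by
          have : (0 : ℝ) < c := by exact_mod_cast hc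
          positivity
        have hden : (γ : ℂ) * c * (ζ * (r : ℂ)) ^ (c - 1) * ζ = ((γ * c * r ^ (c - 1) : ℝ) : ℂ) := by
          have hζc' : ζ ^ (c - 1) * ζ = 1 := by rw [pow_sub_one_mul hc0, hζc]
          push_cast
          linear_combination ((γ : ℂ) * c * (r : ℂ) ^ (c - 1)) * hζc'
        have hquot : -(B.eval (ζ * (r : ℂ)) / A.derivative.eval (ζ * (r : ℂ))) / -ζ =
            (K : ℂ) * rot (a * θ) := by
          rw [neg_div_neg_eq, div_div, hA', hden, hB, eval_pow, eval_X, mul_pow, hζdef, ← rot_nat_mul, hK]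
          push_cast
          ring
        have hv : 0 < (-(B.eval (ζ * (r : ℂ)) / A.derivative.eval (ζ * (r : ℂ))) / -ζ).im := by
          rw [hquot, im_ofReal_mul_rot]
          refine mul_pos hKpos ?_
          rw [show (a : ℝ) * θ = 2 * Real.pi * a / c by rw [hθ]; ring]
          exact sin_two_pi_mul_div_pos ha h2a
        obtain ⟨ρ₁, hρ₁, hev⟩ := exit_lemma (B := B) hzA hane hd hv
        refine ⟨min ρ₁ ((ζ * (r : ℂ)).im / 2), lt_min hρ₁ (by linarith), hev.mono fun s hs' w hw hwρ => ?_⟩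
        have hwρ₁ : ‖w - ζ * (r : ℂ)‖ < ρ₁ := hwρ.trans_le (min_le_left _ _)
        have hwρ₂ : ‖w - ζ * (r : ℂ)‖ < (ζ * (r : ℂ)).im / 2 := hwρ.trans_le (min_le_right _ _)
        have hside := hs' w hw hwρ₁
        -- translate the half-plane condition
        have hζ0 : ζ ≠ 0 := rot_ne_zero θ
        have hrot : (w - ζ * (r : ℂ)) / -ζ = -(w * rot (-θ)) + (r : ℂ) := by
          rw [hζinv]
          field_simp [hζ0]
          ring
        rw [hrot, Complex.add_im, Complex.ofReal_im, add_zero, Complex.neg_im] at hside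
        have hwim : 0 < w.im := by
          have h1 : |(w - ζ * (r : ℂ)).im| ≤ ‖w - ζ * (r : ℂ)‖ := Complex.abs_im_le_norm _
          rw [Complex.sub_im] at h1
          have h2 := (abs_le.1 (h1.trans hwρ₂.le)).1
          linarith
        have hwU : w ∈ trinSector c := by
          rw [mem_trinSector]
          exact ⟨hwim, by linarith⟩
        simp [hwU]
    · -- k ≥ 2: exterior roots
      have hzE : ζ ^ k * (r : ℂ) ∈ trinExterior c := by
        rw [mem_trinExterior, hζdef, ← rot_nat_mul, im_rot_mul_ofReal, mul_assoc,
          show rot (k * θ) * ((r : ℂ) * rot (-θ)) = rot (((k : ℝ) - 1) * θ) * (r : ℂ) by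
            rw [show ((k : ℝ) - 1) * θ = k * θ + -θ by ring, rot_add]; ring,
          im_rot_mul_ofReal]
        rcases sin_exterior hk2 hk with h | h
        · left; nlinarith
        · right; nlinarith
      have hne : ζ ^ k * (r : ℂ) ≠ ζ * (r : ℂ) := by
        intro h
        have h' : ζ ^ k = ζ ^ 1 := by rw [pow_one]; exact mul_right_cancel₀ hr0' h
        have := hζprim.pow_inj hk h1c h'
        omega
      have hzU := not_mem_trinSector_of_mem_trinExterior hzE
      obtain ⟨ρ, hρ, hev⟩ := side_of_isOpen (l := 𝓝[>] (0 : ℝ)) P (V := trinSector c)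
        (isOpen_trinExterior c) hzE fun w hw => by
          simp [not_mem_trinSector_of_mem_trinExterior hw, hzU]
      refine ⟨ρ, hρ, hev.mono fun s hs' w hw hwρ => ?_⟩
      have hwU : w ∉ trinSector c := fun h => hzU ((hs' w hw hwρ).1 h)
      simp [hwU, hne]
  -- the count near 0⁺
  have hcount0 : ∀ᶠ s in 𝓝[>] (0 : ℝ), ((P s).roots.filter (· ∈ trinSector c)).card = 1 := by
    have h := card_roots_filter_eventually_eq (l := 𝓝[>] (0 : ℝ)) nhdsWithin_le_nhds hdeg (htop 0)
      (fun k => (hcont k).continuousAt) (trinSector c) (fun z => z = ζ * (r : ℂ)) hside0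
    refine h.mono fun s hs => hs.trans ?_
    rw [hroots0', Multiset.filter_eq', Multiset.card_replicate]
    refine Multiset.count_eq_one_of_mem ?_ (Multiset.mem_map.2 ⟨1, Multiset.mem_range.2 h1c, by rw [pow_one]⟩)
    refine (Multiset.nodup_map_iff_inj_on (Multiset.nodup_range c)).2 fun i hi j hj hij => ?_
    exact hζprim.pow_inj (Multiset.mem_range.1 hi) (Multiset.mem_range.1 hj) (mul_right_cancel₀ hr0' hij)
  -- (3) constancy on (0, ∞) and conclusion at s = 1
  obtain ⟨s₀, hs₀count, hs₀pos⟩ := (hcount0.and self_mem_nhdsWithin).exists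
  have hconst := card_roots_filter_eq_of_preconnected' hdeg hcont isPreconnected_Ioi
    (fun s _ => htop s) (trinSector c) hsideU hs₀pos (Set.mem_Ioi.2 one_pos)
  rw [hg, ← hconst, hs₀count]

end Trinomial

end TieLaw

end Summit.ValiantsHypothesis.ValiantsHypothesis.Theorems.LacunarySymmetroidMatrixDescartes
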